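import Summits.QuantumFields.BalabanUV.T4Continuum.Support.NE9Lemma1PieceClass
import Summits.QuantumFields.BalabanUV.T4Continuum.Support.NE9MarginalProjectionEnd

/-!
# NE9CPieceCouplingModulus — leaf A3's CHANNEL COUPLING MODULUS `hTcup` for the row owner's CLASS-RELATIVE piece form
`cpieceChannel P` (`NE9Lemma1PieceClass`, located correction F-ne9p1g24-1), bare and ON THE v1.3 DICTIONARY `T := 𝒯 ∘ margProj r A`,
and the END-M read-out face with S3 ∕ S5 ∕ A3 at FORM LEVEL ON THE CLASSES (cell `pub-balaban`, T4-DAG §2 node U3 ∕ §6 NE9;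
NE9 formalisation swarm, unit `b2b-balaban-t4-ne9-formalise-leaf-09` gen 4, own-initiative micro-item CLAIMS.log l.8546
«(w15)-CLASS», at own risk — the twin promised in the RIDER of `NE9PieceCouplingModulusProj` p212076; skeleton
`HOME/t4/b2b-balaban-t4-ne9-p1/SKELETON-NE9-P1.md` v1.3.4 rows A3 (R-4) ∕ RO ∕ AW ∕ MP, C5)

HONEST FRAMING (T4-DAG PAGE 1).  Rung (B)+1 on a FIXED finite torus — NOT infinite volume, NOT a mass gap, NOT the Clay
problem.  NE9 (`T4OutputRate.NE9` ∧ `FadingMemory`) is a cell NEW ESTIMATE, NOT PRINTED, NOT discharged here.  Bookkeeping over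
the ABSTRACT carriers of `T4OutputRate`, the owner's class-relative piece form `NE9Lemma1PieceClass.CPieceData` ∕
`cpieceChannel` (pieces = plain functionals of the input FAMILY, additive and bounded ON A CLASS only) and projection structure
`NE9MarginalProjection`; every analytic input is a DISPLAYED binder stated INLINE (no Prop-valued definition; trigger c3 ∕
referee DV-9).  [I] = [Balaban1987RG1], [II] = [Balaban1988RG2Cluster] quoted for TYPES only (ABSOLUTE RULE).
`FlowStep.BetaPertH`, (B), (B^μ) do not occur.

WHERE THIS SITS.  Crew row (w15) (`NE9PieceCouplingModulus`, leaf-03-g3) and its dictionary twin (`NE9PieceCouplingModulusProj`,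
this unit) derive A3's `hTcup` on g23's CLASS-FREE piece form (`PieceData.piece : (Bg → ℝ) →+ ℝ`).  The owner's located
correction F-ne9p1g24-1 (CLAIMS.log l.8319): that form's class-free per-piece bound cannot host the displayed species and its
everywhere-additive pieces are not the honest (1.23) functionals; the replacement `CPieceData` asks additivity
(`PieceAdditiveOn Adm`) and the S5 per-piece size bound (`PieceBoundOnG Adm`) ON A CLASS.  THIS FILE is the A3 side on that
form: §1 ports (w15)'s theorem — the per-piece COUPLING response compares the SAME family at two histories, so NO additivity is
needed, only the displayed response bound and the [II] p. 8 level counts on the index frame `P.frame` (`levels_boundG`,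
`sum_tauOfG_le` BY NAME); §2–§3 port the dictionary twin — the split `margProj r A (E g) = E g − (scale-wise read-out multiple
of A)` now uses `PieceAdditiveOn Adm` at the two members «`E g ∈ Adm`» (S1) and «scale-wise multiples of the marginal direction
∈ Adm» (displayed, `hAmul`), the read-out coefficient being BACKGROUND-FREE and bounded by RO `ReadSize` on `TermSize` (`N j ≤
Nbar`); §4 applies the owner's END-M read-out face BY NAME at `𝒯 := cpieceChannel P` with S3 from `PieceAdditiveOn MF` ∕
`channelStepSum_cpiece`, S5 from `channelSizeAtStepNN_cpieceG` with the per-piece size bound asked ON THE MARGINAL-FREE CLASS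
`MF` EXACTLY (`PieceBoundOnG MF` — O-ne9p1g22-1's placement and F-ne9p1g24-1's quantifier at once), the profile
`tauOfG c_Q (agePow ω)` (`profileG`; ω = L^{−α}, O-ne9p1g23-1), and A3 := §3, `TermSize` derived FIRST inside the face by END-M's
own internal route (no `TermSize` hypothesis; one displayed scalar `hNb`).  AFTER §4 the dictionary face's channel side
displays ONLY: `PieceZero`, `PieceLocal`, `CSrcScale`, `PieceAdditiveOn Adm` ∕ `PieceAdditiveOn MF`, `PieceBoundOnG MF` (S5),
`hrespE`, `hrespA`, `hAmul`, `LevelCountsG P.frame`, RO (`ReadAdditive` ∕ `ReadZero` ∕ `ReadSize`), AW (`DirSize`), MP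
(`ProjInto`), scalars.  NOT PRINTED and not claimed: anything about Bałaban's (1.23) ∕ (1.33) ∕ (1.20); the instances O-NE9-5 ∕
(w8) ∕ (w9) stay gated on the model O-NE9-1 and the owner's species instance (B).  DISGUISE TEST: every coupling clause
compares two coupling ARGUMENTS `g k`, `g′ k` on the SAME family; sizes are one-history; no joint two-history statement; not NE9.

WHAT IS PROVED (kernel, `[folklore]` bookkeeping; 0 sorry, 0 `def`).
§1 `cstepBlock_sub_eq`, `abs_cstepBlock_sub_le_of_response`, **`channelCouplingModulus_cpiece`** (`hTcup` at `T := cpieceChannel P`,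
   `wt := weightOf P.frame …`, k-uniform `qT := qc·c_Q·(1−ω)⁻¹`).
§2 `cpieceResponse_margProj`.  §3 **`channelCouplingModulus_cpiece_margProj`** (= END-M `_margProj`'s `hTcup` at `𝒯 := cpieceChannel P`,
   `qT := (qc + cr·Nbar·qcA)·c_Q·(1−ω)⁻¹`).
§4 END face **`termSize_ne9_and_fadingMemory_of_couplingTwoPoint_vacSub_sizeInduction_margProj_cpieceForm`** = END-M BY NAME;
   conclusion END-M's with `τbar := c_Q`, `qTbar := (qc + cr·Nbar·qcA)·c_Q·(1−ω)⁻¹`.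

References (TYPES only): [Balaban1987RG1] CMP 109 (1987) (0.29)–(0.30) p. 258, (1.3) p. 260, (1.18) p. 263, (1.20)–(1.22) p. 264,
(2.12)–(2.13) p. 268; [Balaban1988RG2Cluster] CMP 116 (1988) (1.23)–(1.25) p. 7, (1.26)–(1.29) and l. 1–10 p. 8, (1.33)–(1.36) p. 9,
Lemma 3 (2.38) p. 20.
-/

noncomputable section

namespace Summit.QuantumFields.BalabanUV.T4Continuum.NE9CPieceCouplingModulus

open scoped BigOperators
open Literature.MathematicalPhysics.QuantumFieldTheory.Balaban1983to89
open Literature.MathematicalPhysics.QuantumFieldTheory.Balaban1983to89.T4OutputRate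
open Literature.MathematicalPhysics.QuantumFieldTheory.Balaban1983to89.T4HistoryLipschitzRecursion
open Literature.MathematicalPhysics.QuantumFieldTheory.Balaban1983to89.T4HistoryLipschitzOuter
open Literature.MathematicalPhysics.QuantumFieldTheory.Balaban1983to89.T4HistoryLipschitzActivity
open Literature.MathematicalPhysics.QuantumFieldTheory.Balaban1983to89.T4HistoryLipschitzActivity (ClusterGeom)
open Literature.MathematicalPhysics.QuantumFieldTheory.Balaban1983to89.T4HistoryLipschitzSegment
open Summit.QuantumFields.BalabanUV.T4Continuum.NE9Lemma1Counting
open Summit.QuantumFields.BalabanUV.T4Continuum.NE9Lemma1Gain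
open Summit.QuantumFields.BalabanUV.T4Continuum.NE9Lemma1PieceClass
open Summit.QuantumFields.BalabanUV.T4Continuum.NE9LastCouplingBridge
open Summit.QuantumFields.BalabanUV.T4Continuum.NE9BridgeSizeInduction
open Summit.QuantumFields.BalabanUV.T4Continuum.NE9MarginalProjection
open Summit.QuantumFields.BalabanUV.T4Continuum.NE9MarginalProjectionEnd

variable {C : Carriers} {Bg ι α β γ : Type}

/-! ## §1 `hTcup` for the class-relative piece form with a k-uniform constant -/

/-- The difference of two one-creation-step blocks of the SAME input family at two histories is the nested sum of the piece
differences (finite sums; no additivity needed). [folklore] -/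
theorem cstepBlock_sub_eq (P : CPieceData C Bg ι α β γ) (k : ℕ) (s s' : ℕ → ℝ) (H : Bg → C.Dom → ℝ) (y : ι) (j : ℕ) :
    cstepBlock P k s H y j - cstepBlock P k s' H y j =
      ∑ a ∈ P.S0 k y, ∑ b ∈ P.SY k y a, ∑ x ∈ P.src k y a j, (P.piece k s y a b x H - P.piece k s' y a b x H) := by
  simp only [cstepBlock, ← Finset.sum_sub_distrib]

/-- **ONE CREATION STEP (kernel)**: under the displayed per-piece COUPLING-RESPONSE bound of the (1.24)×(1.25) shape (constant
`Kp k y·qc·|s k − s′ k|`, general gain) and the level counts `LevelCountsG` on the index frame with profile `ℓ`, the two histories'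
step-j blocks on the same family differ by at most `Kp·qc·|Δs_k|·O1·(c_Q·ℓ k j)·e·exp(⅛κ₁d₀)·exp(−(1/16)κ₁d_k(Y))` — the owner's
`levels_boundG P.frame` applied to the absolute piece differences. [cite: Balaban1988RG2Cluster, (1.24)-(1.28) pp.7-8] -/
theorem abs_cstepBlock_sub_le_of_response (P : CPieceData C Bg ι α β γ) {κ κ₁ d0 O1 cQ qc : ℝ} {Kp : ℕ → ι → ℝ}
    {gain ℓ : ℕ → ℕ → ℝ} {H : Bg → C.Dom → ℝ} {s s' : ℕ → ℝ} {k : ℕ} {y : ι} {j : ℕ}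
    (hresp : ∀ a ∈ P.S0 k y, ∀ b ∈ P.SY k y a, ∀ x ∈ P.src k y a j,
      |P.piece k s y a b x H - P.piece k s' y a b x H| ≤
        Kp k y * qc * gain k j * Real.exp (-(κ * C.d x)) *
          Real.exp (-(1 / 8) * (κ₁ - 1) * P.dY k y + (1 / 8) * κ₁ * d0 - (1 / 2) * (κ₁ - 1) * P.vol k y a b) *
            |s k - s' k|)
    (hL : LevelCountsG P.frame κ κ₁ O1 cQ gain ℓ) (hKp : 0 ≤ Kp k y) (hqc : 0 ≤ qc) (hO1 : 0 ≤ O1)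
    (hgain : ∀ k j, 0 ≤ gain k j) (hcQℓ : ∀ k j, 0 ≤ cQ * ℓ k j) :
    |cstepBlock P k s H y j - cstepBlock P k s' H y j| ≤
      Kp k y * qc * |s k - s' k| * O1 * (cQ * ℓ k j) * Real.exp 1 * Real.exp ((1 / 8) * κ₁ * d0) *
        Real.exp (-(1 / 16) * κ₁ * P.frame.dY k y) := by
  rw [cstepBlock_sub_eq]
  have h1 : |∑ a ∈ P.S0 k y, ∑ b ∈ P.SY k y a, ∑ x ∈ P.src k y a j, (P.piece k s y a b x H - P.piece k s' y a b x H)| ≤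
      ∑ a ∈ P.S0 k y, ∑ b ∈ P.SY k y a, ∑ x ∈ P.src k y a j, |P.piece k s y a b x H - P.piece k s' y a b x H| := by
    refine (Finset.abs_sum_le_sum_abs _ _).trans (Finset.sum_le_sum fun a _ => ?_)
    refine (Finset.abs_sum_le_sum_abs _ _).trans (Finset.sum_le_sum fun b _ => ?_)
    exact Finset.abs_sum_le_sum_abs _ _
  have hK : 0 ≤ Kp k y * qc * |s k - s' k| := mul_nonneg (mul_nonneg hKp hqc) (abs_nonneg _)
  have h2 := levels_boundG P.frame hL hK hO1 hgain hcQℓ k y j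
    (fun a b x => |P.piece k s y a b x H - P.piece k s' y a b x H|)
    (fun a _ b _ x _ => abs_nonneg _)
    (fun a ha b hb x hx => by
      calc |P.piece k s y a b x H - P.piece k s' y a b x H|
          ≤ Kp k y * qc * gain k j * Real.exp (-(κ * C.d x)) *
              Real.exp (-(1 / 8) * (κ₁ - 1) * P.dY k y + (1 / 8) * κ₁ * d0 - (1 / 2) * (κ₁ - 1) * P.vol k y a b) *
                |s k - s' k| := hresp a ha b hb x hx
        _ = Kp k y * qc * |s k - s' k| * gain k j * Real.exp (-(κ * C.d x)) *
              Real.exp (-(1 / 8) * (κ₁ - 1) * P.dY k y + (1 / 8) * κ₁ * d0 - (1 / 2) * (κ₁ - 1) * P.vol k y a b) := by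
            ring)
  exact h1.trans h2

/-- **LEAF A3 ON THE CLASS-RELATIVE PIECE FORM WITH A k-UNIFORM CONSTANT (kernel; (w15) ported).**  DISPLAYED (inline, asserted
nowhere for Bałaban's objects): for every pair of window histories, step `k`, output `y`, box, domain, creation step `j` and
source `x`, the FAMILY-level piece at the two histories applied to the SAME family `H g` differs by at most
`Kp k y·qc·gain k j·e^{−κd(x)}·exp(−⅛(κ₁−1)d_k(Y) + ⅛κ₁d₀ − ½(κ₁−1)·vol)·|g k − g′ k|` (TYPE = [II] (1.24)×(1.25) read for the
s-derivative of the piece through 𝐇_k(s); PROOF-INTERIOR (I.3.54) — for the displayed species `NE9RemainderPieceCoupling`);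
`LevelCountsG P.frame κ κ₁ O1 c_Q gain (agePow ω)` BY NAME; scalars.  CONCLUSION: LITERALLY the END's `hTcup` at
`T := cpieceChannel P`, `wt := weightOf P.frame κ₁ d₀ O1 Kp`, k-UNIFORM `qT k := qc·c_Q·(1 − ω)⁻¹` ([I] (0.30) shape,
`sum_tauOfG_le`).  No additivity of the pieces is used.
[cite: Balaban1988RG2Cluster, (1.23)-(1.29) pp.7-8, (1.33)-(1.36) p.9; Balaban1987RG1, (0.30) p.258, (2.12)-(2.13) p.268] -/
theorem channelCouplingModulus_cpiece (P : CPieceData C Bg ι α β γ) {W : Set (ℕ → ℝ)} {H : (ℕ → ℝ) → Bg → C.Dom → ℝ}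
    {κ κ₁ d0 O1 cQ ω qc : ℝ} {Kp : ℕ → ι → ℝ} {gain : ℕ → ℕ → ℝ}
    (hresp : ∀ g ∈ W, ∀ g' ∈ W, ∀ (k : ℕ) (y : ι), ∀ a ∈ P.S0 k y, ∀ b ∈ P.SY k y a, ∀ (j : ℕ), ∀ x ∈ P.src k y a j,
      |P.piece k g y a b x (H g) - P.piece k g' y a b x (H g)| ≤
        Kp k y * qc * gain k j * Real.exp (-(κ * C.d x)) *
          Real.exp (-(1 / 8) * (κ₁ - 1) * P.dY k y + (1 / 8) * κ₁ * d0 - (1 / 2) * (κ₁ - 1) * P.vol k y a b) *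
            |g k - g' k|)
    (hL : LevelCountsG P.frame κ κ₁ O1 cQ gain (agePow ω)) (hKp : ∀ k y, 0 ≤ Kp k y) (hqc : 0 ≤ qc) (hO1 : 0 ≤ O1)
    (hgain : ∀ k j, 0 ≤ gain k j) (hcQ : 0 ≤ cQ) (hω0 : 0 ≤ ω) (hω1 : ω < 1) :
    ∀ g ∈ W, ∀ g' ∈ W, ∀ (k : ℕ) (y : ι),
      |cpieceChannel P k g (H g) y - cpieceChannel P k g' (H g) y| ≤
        weightOf P.frame κ₁ d0 O1 Kp k y * (qc * cQ * (1 - ω)⁻¹ * |g k - g' k|) := by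
  intro g hg g' hg' k y
  have hcQℓ : ∀ k j, 0 ≤ cQ * agePow ω k j := fun k j => mul_nonneg hcQ (agePow_nonneg hω0 k j)
  set A : ℝ := Kp k y * qc * |g k - g' k| * O1 * Real.exp 1 * Real.exp ((1 / 8) * κ₁ * d0) *
    Real.exp (-(1 / 16) * κ₁ * P.frame.dY k y) with hA
  have hA0 : 0 ≤ A := by
    rw [hA]
    have := hKp k y
    positivity
  have hstep : ∀ j ∈ Finset.range (k + 1),
      |cstepBlock P k g (H g) y j - cstepBlock P k g' (H g) y j| ≤ A * tauOfG cQ (agePow ω) k j := by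
    intro j _
    have h := abs_cstepBlock_sub_le_of_response P (s := g) (s' := g') (H := H g) (k := k) (y := y) (j := j)
      (fun a ha b hb x hx => hresp g hg g' hg' k y a ha b hb j x hx) hL (hKp k y) hqc hO1 hgain hcQℓ
    calc |cstepBlock P k g (H g) y j - cstepBlock P k g' (H g) y j| ≤ _ := h
      _ = A * tauOfG cQ (agePow ω) k j := by rw [hA]; simp only [tauOfG]; ring
  rw [cpieceChannel_eq_sum_cstepBlock, cpieceChannel_eq_sum_cstepBlock, ← Finset.sum_sub_distrib]
  calc |∑ j ∈ Finset.range (k + 1), (cstepBlock P k g (H g) y j - cstepBlock P k g' (H g) y j)|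
      ≤ ∑ j ∈ Finset.range (k + 1), |cstepBlock P k g (H g) y j - cstepBlock P k g' (H g) y j| :=
        Finset.abs_sum_le_sum_abs _ _
    _ ≤ ∑ j ∈ Finset.range (k + 1), A * tauOfG cQ (agePow ω) k j := Finset.sum_le_sum hstep
    _ = A * ∑ j ∈ Finset.range (k + 1), tauOfG cQ (agePow ω) k j := by rw [Finset.mul_sum]
    _ ≤ A * (cQ * (1 - ω)⁻¹) := mul_le_mul_of_nonneg_left (sum_tauOfG_le hcQ hω0 hω1 k) hA0
    _ = weightOf P.frame κ₁ d0 O1 Kp k y * (qc * cQ * (1 - ω)⁻¹ * |g k - g' k|) := by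
        rw [hA]; simp only [weightOf]; ring

/-! ## §2 The per-piece coupling response of the read-out-projected family (additivity ON THE CLASS) -/

/-- **PER-PIECE COUPLING RESPONSE OF THE PROJECTED OLD TERMS, CLASS-RELATIVE (kernel).**  DISPLAYED: the owner's
`PieceAdditiveOn Adm P`; the memberships «`E g ∈ Adm`» (S1) and «scale-wise multiples `U X ↦ c(scale X)·A U X` of the marginal
direction ∈ Adm» (`hAmul`); the terms' per-piece coupling response `hrespE` ((w15)'s shape at `H := E`); the per-piece coupling
response of those multiples `hrespA` with the factor `|c (scale x)|` (TYPE: the one-cube Wilson action is analytic in the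
background on (1.11)–(1.14) p. 262 of [I] — elementary with the model, like row AW); RO `ReadSize Adm r κ cr` on `TermSize E W κ N`
with `N j ≤ Nbar`.  Since `margProj r A (E g) = E g − (U X ↦ r_{scale X}(E g↾scale X)·A U X)` with BACKGROUND-FREE coefficients, the
projected family's per-piece response has (w15)'s shape with `qc ↦ qc + cr·Nbar·qcA`.
[cite: Balaban1987RG1, (1.18) p.263, (1.20)-(1.22) p.264, (2.12)-(2.13) p.268; Balaban1988RG2Cluster, (1.23)-(1.25) p.7] -/
theorem cpieceResponse_margProj (P : CPieceData C Bg ι α β γ) {E : Functional C Bg} {W : Set (ℕ → ℝ)}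
    {Adm : Set (Bg → C.Dom → ℝ)} {r : ℕ → (Bg → C.Dom → ℝ) → ℝ} {A : Bg → C.Dom → ℝ}
    {κ κ₁ d0 cr qc qcA Nbar : ℝ} {Kp : ℕ → ι → ℝ} {gain : ℕ → ℕ → ℝ} {N : ℕ → ℝ}
    (hadd : PieceAdditiveOn Adm P) (hAdmE : ∀ g ∈ W, E g ∈ Adm)
    (hAmul : ∀ c : ℕ → ℝ, (fun U X => c (C.scale X) * A U X) ∈ Adm)
    (hrespE : ∀ g ∈ W, ∀ g' ∈ W, ∀ (k : ℕ) (y : ι), ∀ a ∈ P.S0 k y, ∀ b ∈ P.SY k y a, ∀ (j : ℕ), ∀ x ∈ P.src k y a j,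
      |P.piece k g y a b x (E g) - P.piece k g' y a b x (E g)| ≤
        Kp k y * qc * gain k j * Real.exp (-(κ * C.d x)) *
          Real.exp (-(1 / 8) * (κ₁ - 1) * P.dY k y + (1 / 8) * κ₁ * d0 - (1 / 2) * (κ₁ - 1) * P.vol k y a b) *
            |g k - g' k|)
    (hrespA : ∀ g ∈ W, ∀ g' ∈ W, ∀ (k : ℕ) (y : ι), ∀ a ∈ P.S0 k y, ∀ b ∈ P.SY k y a, ∀ (j : ℕ), ∀ x ∈ P.src k y a j,
      ∀ c : ℕ → ℝ, |P.piece k g y a b x (fun U X => c (C.scale X) * A U X) -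
          P.piece k g' y a b x (fun U X => c (C.scale X) * A U X)| ≤
        |c (C.scale x)| * (Kp k y * qcA * gain k j * Real.exp (-(κ * C.d x)) *
          Real.exp (-(1 / 8) * (κ₁ - 1) * P.dY k y + (1 / 8) * κ₁ * d0 - (1 / 2) * (κ₁ - 1) * P.vol k y a b) *
            |g k - g' k|))
    (hrs : ReadSize Adm r κ cr) (hT : TermSize E W κ N) (hN0 : ∀ j, 0 ≤ N j) (hNb : ∀ j, N j ≤ Nbar) (hcr : 0 ≤ cr)
    (hKp : ∀ k y, 0 ≤ Kp k y) (hqcA : 0 ≤ qcA) (hgain : ∀ k j, 0 ≤ gain k j) :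
    ∀ g ∈ W, ∀ g' ∈ W, ∀ (k : ℕ) (y : ι), ∀ a ∈ P.S0 k y, ∀ b ∈ P.SY k y a, ∀ (j : ℕ), ∀ x ∈ P.src k y a j,
      |P.piece k g y a b x (margProj r A (E g)) - P.piece k g' y a b x (margProj r A (E g))| ≤
        Kp k y * (qc + cr * Nbar * qcA) * gain k j * Real.exp (-(κ * C.d x)) *
          Real.exp (-(1 / 8) * (κ₁ - 1) * P.dY k y + (1 / 8) * κ₁ * d0 - (1 / 2) * (κ₁ - 1) * P.vol k y a b) *
            |g k - g' k| := by
  intro g hg g' hg' k y a ha b hb j x hx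
  -- the background-free read-out coefficients, scale by scale, and their size
  have hρ : |r (C.scale x) (restrictScale (C.scale x) (E g))| ≤ cr * Nbar := by
    have h := hrs (C.scale x) (E g) (hAdmE g hg) (N (C.scale x)) (hN0 _)
      (fun V Y hY => by rw [← hY]; exact hT g hg V Y)
    exact h.trans (mul_le_mul_of_nonneg_left (hNb _) hcr)
  -- the projected family = terms − scale-wise read-out multiple of the marginal direction
  have hfun : margProj r A (E g) =
      E g - fun U X => (fun j => r j (restrictScale j (E g))) (C.scale X) * A U X := by
    funext U X
    simp only [margProj, Pi.sub_apply]
  have hmem : (fun U X => (fun j => r j (restrictScale j (E g))) (C.scale X) * A U X) ∈ Adm :=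
    hAmul fun j => r j (restrictScale j (E g))
  rw [hfun, hadd k g y a b x (E g) (hAdmE g hg) _ hmem, hadd k g' y a b x (E g) (hAdmE g hg) _ hmem]
  have hA' := hrespA g hg g' hg' k y a ha b hb j x hx fun j => r j (restrictScale j (E g))
  have hrew : P.piece k g y a b x (E g) -
        P.piece k g y a b x (fun U X => (fun j => r j (restrictScale j (E g))) (C.scale X) * A U X) -
      (P.piece k g' y a b x (E g) -
        P.piece k g' y a b x (fun U X => (fun j => r j (restrictScale j (E g))) (C.scale X) * A U X)) =
      (P.piece k g y a b x (E g) - P.piece k g' y a b x (E g)) -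
      (P.piece k g y a b x (fun U X => (fun j => r j (restrictScale j (E g))) (C.scale X) * A U X) -
        P.piece k g' y a b x (fun U X => (fun j => r j (restrictScale j (E g))) (C.scale X) * A U X)) := by ring
  rw [hrew]
  have hG : 0 ≤ Kp k y * qcA * gain k j * Real.exp (-(κ * C.d x)) *
      Real.exp (-(1 / 8) * (κ₁ - 1) * P.dY k y + (1 / 8) * κ₁ * d0 - (1 / 2) * (κ₁ - 1) * P.vol k y a b) *
        |g k - g' k| := by
    have := hKp k y; have := hgain k j; positivity
  refine (abs_sub _ _).trans ?_
  calc |P.piece k g y a b x (E g) - P.piece k g' y a b x (E g)| +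
        |P.piece k g y a b x (fun U X => (fun j => r j (restrictScale j (E g))) (C.scale X) * A U X) -
          P.piece k g' y a b x (fun U X => (fun j => r j (restrictScale j (E g))) (C.scale X) * A U X)|
      ≤ Kp k y * qc * gain k j * Real.exp (-(κ * C.d x)) *
          Real.exp (-(1 / 8) * (κ₁ - 1) * P.dY k y + (1 / 8) * κ₁ * d0 - (1 / 2) * (κ₁ - 1) * P.vol k y a b) *
            |g k - g' k| +
        cr * Nbar * (Kp k y * qcA * gain k j * Real.exp (-(κ * C.d x)) *
          Real.exp (-(1 / 8) * (κ₁ - 1) * P.dY k y + (1 / 8) * κ₁ * d0 - (1 / 2) * (κ₁ - 1) * P.vol k y a b) *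
            |g k - g' k|) :=
        add_le_add (hrespE g hg g' hg' k y a ha b hb j x hx) (hA'.trans (mul_le_mul_of_nonneg_right hρ hG))
    _ = Kp k y * (qc + cr * Nbar * qcA) * gain k j * Real.exp (-(κ * C.d x)) *
          Real.exp (-(1 / 8) * (κ₁ - 1) * P.dY k y + (1 / 8) * κ₁ * d0 - (1 / 2) * (κ₁ - 1) * P.vol k y a b) *
            |g k - g' k| := by ring

/-! ## §3 `hTcup` for the class-relative piece form on the read-out dictionary -/

/-- **LEAF A3 ON THE v1.3 DICTIONARY, CLASS-RELATIVE PIECE FORM (kernel; the theorem of this file).**  §1 at the PROJECTED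
input family `H g := margProj r A (E g)` with its per-piece coupling response supplied by §2.  CONCLUSION: LITERALLY the binder
`hTcup` of the owner's END-M face `NE9MarginalProjectionEnd.…_vacSub_sizeInduction_margProj` at `𝒯 := cpieceChannel P`, with
`wt := weightOf P.frame κ₁ d₀ O1 Kp` and the k-UNIFORM `qT k := (qc + cr·Nbar·qcA)·c_Q·(1 − ω)⁻¹`.
[cite: Balaban1987RG1, (0.30) p.258, (1.20)-(1.22) p.264, (2.12)-(2.13) p.268; Balaban1988RG2Cluster, (1.23)-(1.29) pp.7-8, (1.33)-(1.36) p.9] -/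
theorem channelCouplingModulus_cpiece_margProj (P : CPieceData C Bg ι α β γ) {E : Functional C Bg} {W : Set (ℕ → ℝ)}
    {Adm : Set (Bg → C.Dom → ℝ)} {r : ℕ → (Bg → C.Dom → ℝ) → ℝ} {A : Bg → C.Dom → ℝ}
    {κ κ₁ d0 O1 cQ ω cr qc qcA Nbar : ℝ} {Kp : ℕ → ι → ℝ} {gain : ℕ → ℕ → ℝ} {N : ℕ → ℝ}
    (hadd : PieceAdditiveOn Adm P) (hAdmE : ∀ g ∈ W, E g ∈ Adm)
    (hAmul : ∀ c : ℕ → ℝ, (fun U X => c (C.scale X) * A U X) ∈ Adm)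
    (hrespE : ∀ g ∈ W, ∀ g' ∈ W, ∀ (k : ℕ) (y : ι), ∀ a ∈ P.S0 k y, ∀ b ∈ P.SY k y a, ∀ (j : ℕ), ∀ x ∈ P.src k y a j,
      |P.piece k g y a b x (E g) - P.piece k g' y a b x (E g)| ≤
        Kp k y * qc * gain k j * Real.exp (-(κ * C.d x)) *
          Real.exp (-(1 / 8) * (κ₁ - 1) * P.dY k y + (1 / 8) * κ₁ * d0 - (1 / 2) * (κ₁ - 1) * P.vol k y a b) *
            |g k - g' k|)
    (hrespA : ∀ g ∈ W, ∀ g' ∈ W, ∀ (k : ℕ) (y : ι), ∀ a ∈ P.S0 k y, ∀ b ∈ P.SY k y a, ∀ (j : ℕ), ∀ x ∈ P.src k y a j,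
      ∀ c : ℕ → ℝ, |P.piece k g y a b x (fun U X => c (C.scale X) * A U X) -
          P.piece k g' y a b x (fun U X => c (C.scale X) * A U X)| ≤
        |c (C.scale x)| * (Kp k y * qcA * gain k j * Real.exp (-(κ * C.d x)) *
          Real.exp (-(1 / 8) * (κ₁ - 1) * P.dY k y + (1 / 8) * κ₁ * d0 - (1 / 2) * (κ₁ - 1) * P.vol k y a b) *
            |g k - g' k|))
    (hrs : ReadSize Adm r κ cr) (hT : TermSize E W κ N) (hN0 : ∀ j, 0 ≤ N j) (hNb : ∀ j, N j ≤ Nbar) (hcr : 0 ≤ cr)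
    (hL : LevelCountsG P.frame κ κ₁ O1 cQ gain (agePow ω)) (hKp : ∀ k y, 0 ≤ Kp k y) (hqc : 0 ≤ qc) (hqcA : 0 ≤ qcA)
    (hO1 : 0 ≤ O1) (hgain : ∀ k j, 0 ≤ gain k j) (hcQ : 0 ≤ cQ) (hω0 : 0 ≤ ω) (hω1 : ω < 1) :
    ∀ g ∈ W, ∀ g' ∈ W, ∀ (k : ℕ) (y : ι),
      |compProj (cpieceChannel P) (margProj r A) k g (E g) y - compProj (cpieceChannel P) (margProj r A) k g' (E g) y| ≤
        weightOf P.frame κ₁ d0 O1 Kp k y * ((qc + cr * Nbar * qcA) * cQ * (1 - ω)⁻¹ * |g k - g' k|) := by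
  have hNbar : 0 ≤ Nbar := (hN0 0).trans (hNb 0)
  have hq : 0 ≤ qc + cr * Nbar * qcA := by positivity
  exact channelCouplingModulus_cpiece P (H := fun g => margProj r A (E g))
    (cpieceResponse_margProj P hadd hAdmE hAmul hrespE hrespA hrs hT hN0 hNb hcr hKp hqcA hgain) hL hKp hq hO1 hgain hcQ
    hω0 hω1

/-! ## §4 The END-M read-out face with the channel side at form level ON THE CLASSES -/

section EndFace

variable (G : ClusterGeom C) {Pot : Type*} [NormedAddCommGroup Pot] [NormedSpace ℂ Pot]

/-- **NE9 ∧ FADING MEMORY ∧ TERM SIZE ON THE v1.3 DICTIONARY, CHANNEL SIDE AT FORM LEVEL ON THE CLASSES (kernel end-to-end).**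
The owner's END-M face `NE9MarginalProjectionEnd.ne9_and_fadingMemory_of_couplingTwoPoint_vacSub_sizeInduction_margProj` APPLIED
BY NAME at `𝒯 := cpieceChannel P`, `wt := weightOf P.frame κ₁ d₀ O1 Kp`, `τ := tauOfG c_Q (agePow ω)` with: S3 `ChannelAdditive MF 𝒯`
:= `channelAdditive_cpiece` from `PieceAdditiveOn MF`, `ChannelStepSum MF 𝒯` := `channelStepSum_cpiece` from `PieceZero` ∕
`PieceLocal` ∕ `CSrcScale`; S5 `ChannelSizeAtStepNN MF 𝒯 κ wt τ` := the owner's `channelSizeAtStepNN_cpieceG` from the per-piece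
size bound asked ON THE MARGINAL-FREE CLASS, `PieceBoundOnG MF`, + `LevelCountsG P.frame`; profile binders from `profileG`
(`τbar := c_Q`); A3 `hTcup` := §3 (additivity on `Adm` for the dictionary split), its `TermSize E W κ N` input derived FIRST by
END-M's own internal route (`termSize_of_recursion_vacSub` ∘ `channelSizeNN_of_perStepNN` ∘ `channelStepSum_compProj` ∕
`channelSizeAtStepNN_compProj` ∘ `projScaleComm_margProj` ∕ `projSize_margProj`) — no `TermSize` hypothesis, one displayed scalar
`hNb`.  Every other END-M binder VERBATIM.  Conclusion = END-M's with `τbar := c_Q`, `qTbar := (qc + cr·Nbar·qcA)·c_Q·(1−ω)⁻¹`.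
Nothing of [I]–[II] asserted; NE9 NOT PROVED; 0∕9 unchanged.
[cite: Balaban1987RG1, (0.28)-(0.30) p.258, (1.3) p.260, (1.18) p.263, (1.20)-(1.22) p.264, (2.12)-(2.14) p.268; Balaban1988RG2Cluster, (1.23)-(1.29) pp.7-8, (1.33)-(1.36) p.9, Lemma 3 (2.38) p.20] -/
theorem termSize_ne9_and_fadingMemory_of_couplingTwoPoint_vacSub_sizeInduction_margProj_cpieceForm
    (P : CPieceData C Bg ι α β γ) {E : Functional C Bg} {W : Set (ℕ → ℝ)} {Adm MF : Set (Bg → C.Dom → ℝ)}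
    {r : ℕ → (Bg → C.Dom → ℝ) → ℝ} {A : Bg → C.Dom → ℝ}
    {Ψ : ℕ → ℝ → (ι → ℝ) → Bg → C.Dom → ℝ} {act : ℕ → ℝ → Bg → Pot → G.P → ℂ} {𝒜 : ℕ → Set Pot}
    {n : ℕ → ℝ → Bg → G.P → ℝ} {lip clip : ℕ → ℝ} {a d : G.P → ℝ} {δ : C.Dom → ℝ}
    {κ κ₁ d0 O1 cQ ω qc qcA Nbar B lipbar clipbar cr aA : ℝ} {Kp : ℕ → ι → ℝ} {gain : ℕ → ℕ → ℝ} {p₀ N : ℕ → ℝ}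
    (ρ : ℕ → (ι → ℝ) → Pot) (U₀ : Bg) (explZ : ℕ → Bg → C.Dom → ℝ) (h0 : ScaleZeroFree E W)
    (hAdm : AdmissibleTerms E W Adm) (hres : AdmRestrict Adm)
    -- the read-out, the marginal direction, the marginal-free class (owner's v1.3, verbatim)
    (hrA : ReadAdditive Adm r) (hr0 : ReadZero r) (hrs : ReadSize Adm r κ cr) (hA : DirSize A κ aA) (hcr : 0 ≤ cr)
    (haA : 0 ≤ aA) (hPinto : ProjInto Adm MF (margProj r A))
    -- the channel side at FORM LEVEL on the classes (owner's `NE9Lemma1PieceClass` binders + the two coupling responses)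
    (hP0 : PieceZero P) (hloc : PieceLocal P) (hsrc : CSrcScale P)
    (hadd : PieceAdditiveOn Adm P) (haddMF : PieceAdditiveOn MF P)
    (hPiece : PieceBoundOnG MF P κ κ₁ d0 Kp gain) (hL : LevelCountsG P.frame κ κ₁ O1 cQ gain (agePow ω))
    (hAmul : ∀ c : ℕ → ℝ, (fun U X => c (C.scale X) * A U X) ∈ Adm)
    (hrespE : ∀ g ∈ W, ∀ g' ∈ W, ∀ (k : ℕ) (y : ι), ∀ a' ∈ P.S0 k y, ∀ b ∈ P.SY k y a', ∀ (j : ℕ), ∀ x ∈ P.src k y a' j,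
      |P.piece k g y a' b x (E g) - P.piece k g' y a' b x (E g)| ≤
        Kp k y * qc * gain k j * Real.exp (-(κ * C.d x)) *
          Real.exp (-(1 / 8) * (κ₁ - 1) * P.dY k y + (1 / 8) * κ₁ * d0 - (1 / 2) * (κ₁ - 1) * P.vol k y a' b) *
            |g k - g' k|)
    (hrespA : ∀ g ∈ W, ∀ g' ∈ W, ∀ (k : ℕ) (y : ι), ∀ a' ∈ P.S0 k y, ∀ b ∈ P.SY k y a', ∀ (j : ℕ), ∀ x ∈ P.src k y a' j,
      ∀ c : ℕ → ℝ, |P.piece k g y a' b x (fun U X => c (C.scale X) * A U X) -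
          P.piece k g' y a' b x (fun U X => c (C.scale X) * A U X)| ≤
        |c (C.scale x)| * (Kp k y * qcA * gain k j * Real.exp (-(κ * C.d x)) *
          Real.exp (-(1 / 8) * (κ₁ - 1) * P.dY k y + (1 / 8) * κ₁ * d0 - (1 / 2) * (κ₁ - 1) * P.vol k y a' b) *
            |g k - g' k|))
    (hKp : ∀ k y, 0 ≤ Kp k y) (hqc : 0 ≤ qc) (hqcA : 0 ≤ qcA) (hO1 : 0 ≤ O1) (hgain : ∀ k j, 0 ≤ gain k j)
    (hcQ : 0 ≤ cQ) (hω0 : 0 ≤ ω) (hω1 : ω < 1) (hNb : ∀ j, N j ≤ Nbar)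
    -- g21's remaining binders at `T := cpieceChannel P ∘ margProj r A` (END-M, verbatim)
    (hfac : Factorises E W (compProj (cpieceChannel P) (margProj r A)) Ψ) (hclip0 : ∀ k, 0 ≤ clip k)
    (hCup : ∀ g ∈ W, ∀ g' ∈ W, ∀ (k : ℕ) (U : Bg) (X : C.Dom), C.scale X = k + 1 → ∀ Q ∈ 𝒜 k, ∀ γ' ∈ G.vol X,
      ‖act k (g k) U Q γ'‖ ≤ n k (g' k) U γ' ∧
        ‖act k (g k) U Q γ' - act k (g' k) U Q γ'‖ ≤ clip k * |g k - g' k| * n k (g' k) U γ')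
    (hreprV : ∀ (k : ℕ) (s : ℝ) (Q : ι → ℝ) (U : Bg) (X : C.Dom),
      Ψ k s Q U X = (G.newTerm act k s U X (ρ k Q)).re - (G.newTerm act k s U₀ X (ρ k Q)).re + explZ k U X)
    (hclipb : ∀ k, clip k ≤ clipbar)
    (hK : TwoPointKP G W act 𝒜 n lip a d) (hdec : G.DecayExtract δ d) (hpin : G.PinBudget a δ (fun _ => B) κ)
    (hρ : ∀ (k : ℕ) (Q Q' : ι → ℝ) (M : ℝ),
      (∀ y, |Q y - Q' y| ≤ weightOf P.frame κ₁ d0 O1 Kp k y * M) → ‖ρ k Q - ρ k Q'‖ ≤ M)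
    (hexplZ : ∀ (k : ℕ) (U : Bg) (X : C.Dom), C.scale X = k + 1 → |explZ k U X| ≤ Real.exp (-(κ * C.d X)) * p₀ k)
    (hbase : ∀ g ∈ W, ∀ (U : Bg) (X : C.Dom), C.scale X = 0 → |E g U X| ≤ Real.exp (-(κ * C.d X)) * N 0)
    (hNsucc : ∀ j, p₀ j + 2 * B ≤ N (j + 1)) (hNnn : ∀ j, 0 ≤ N j)
    (hbox : ∀ (k : ℕ) (Q : ι → ℝ),
      (∀ y, |Q y| ≤ weightOf P.frame κ₁ d0 O1 Kp k y *
        sizeRadius (fun k j => (1 + cr * aA) * tauOfG cQ (agePow ω) k j) N k) → ρ k Q ∈ 𝒜 k)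
    (hB : 0 ≤ B) (hlipb : ∀ k, lip k ≤ lipbar) (hpos : 0 < ω + 8 * lipbar * B * ((1 + cr * aA) * cQ)) :
    TermSize E W κ N ∧
      NE9 E W κ (prodModuli (8 * clipbar * B + 8 * lipbar * B * ((qc + cr * Nbar * qcA) * cQ * (1 - ω)⁻¹))
        fun _ => ω + 8 * lipbar * B * ((1 + cr * aA) * cQ)) ∧
        FadingMemory ((8 * clipbar * B + 8 * lipbar * B * ((qc + cr * Nbar * qcA) * cQ * (1 - ω)⁻¹)) /
            (ω + 8 * lipbar * B * ((1 + cr * aA) * cQ)))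
          (ω + 8 * lipbar * B * ((1 + cr * aA) * cQ))
          (prodModuli (8 * clipbar * B + 8 * lipbar * B * ((qc + cr * Nbar * qcA) * cQ * (1 - ω)⁻¹))
            fun _ => ω + 8 * lipbar * B * ((1 + cr * aA) * cQ)) := by
  have hcQℓ : ∀ k j, 0 ≤ cQ * agePow ω k j := fun k j => mul_nonneg hcQ (agePow_nonneg hω0 k j)
  -- S3 / S5 on the marginal-free class, from the owner's class-relative piece lemmas
  have hadd' : ChannelAdditive MF (cpieceChannel P) := channelAdditive_cpiece haddMF
  have hsum' : ChannelStepSum MF (cpieceChannel P) := channelStepSum_cpiece hP0 hloc hsrc MF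
  have hstep' : ChannelSizeAtStepNN MF (cpieceChannel P) κ (weightOf P.frame κ₁ d0 O1 Kp) (tauOfG cQ (agePow ω)) :=
    channelSizeAtStepNN_cpieceG hP0 hloc hsrc hPiece hL hKp hO1 hgain hcQℓ
  have hτ : ∀ k j, j ≤ k → 0 ≤ tauOfG cQ (agePow ω) k j ∧ tauOfG cQ (agePow ω) k j ≤ cQ * ω ^ (k - j) :=
    fun k j hjk => ⟨hcQℓ k j, (profileG hcQ hω0).1 k j hjk⟩
  -- the size profile FIRST (END-M's own internal route; one-history binders only)
  have hPcomm : ProjScaleComm Adm (margProj r A) := projScaleComm_margProj Adm A hr0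
  have hPsize : ProjSize Adm (margProj r A) κ (cr * aA) := projSize_margProj hrs hA hcr
  have hc : 0 ≤ cr * aA := mul_nonneg hcr haA
  have hT : TermSize E W κ N :=
    (termSize_of_recursion_vacSub G ρ U₀ explZ hAdm
      (channelSizeNN_of_perStepNN hres (channelStepSum_compProj hPcomm hPinto hsum')
        (channelSizeAtStepNN_compProj hPcomm hPinto hPsize hc hstep'))
      hfac hK hdec hpin hreprV hexplZ hbase hNsucc hNnn hbox).1
  -- A3 on the dictionary (§3)
  have hTcup := channelCouplingModulus_cpiece_margProj P hadd hAdm.1 hAmul hrespE hrespA hrs hT hNnn hNb hcr hL hKp hqc hqcA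
    hO1 hgain hcQ hω0 hω1
  have hNbar : 0 ≤ Nbar := (hNnn 0).trans (hNb 0)
  have hq0 : 0 ≤ (qc + cr * Nbar * qcA) * cQ * (1 - ω)⁻¹ := by
    have : 0 < 1 - ω := by linarith
    positivity
  exact ne9_and_fadingMemory_of_couplingTwoPoint_vacSub_sizeInduction_margProj G
    (qT := fun _ => (qc + cr * Nbar * qcA) * cQ * (1 - ω)⁻¹) ρ U₀ explZ h0 hAdm hres hrA hr0 hrs hA hcr haA hPinto hadd' hsum'
    hstep' hfac hclip0 hCup (fun _ => hq0) hTcup hreprV hclipb (fun _ => le_rfl) hK hdec hpin hρ hexplZ hbase hNsucc hNnn hbox hB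
    hlipb hcQ hω0 hpos hτ

end EndFace

end Summit.QuantumFields.BalabanUV.T4Continuum.NE9CPieceCouplingModulus

end
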